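import Summits.QuantumFields.YangMills.Theorems.ColdStartUniversalityLatticeLangevinWeightedHessianPlaquette
import Summits.QuantumFields.YangMills.Theorems.ColdStartUniversalityLatticeLangevinWeightedCurvature
import Summits.QuantumFields.YangMills.Theorems.ColdStartUniversalityLatticeLangevinPlaquetteFirstVariation
import HarnessLib

/-!
# Route `ColdStartUniversality` (fixed-cut-off package, Bakry–Émery side, WEIGHTED gradient bounds): the EXPLICIT WEIGHTED HESSIAN
# BOUND `K₀(b) = (8 + 12(b² + 1)/b)·|β'|` for link weights of plaquette ratio at most `b²`

Helper file (seat `ym-line-csu-p1`, g43; `--supports stmt-QuantumFields-24809`).  Discharges the hypothesis `hHess` of the weighted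
curvature inequality `generator_wcarre_sub_ge_of_whessBound` (`…WeightedCurvature`) for every POSITIVE link weight `c` on `(ℤ/L)³`
whose values on two links of a common plaquette differ by a factor at most `b²` (`b ≥ 1`):
★★ `wilson_whessBound` — for every configuration `V` and every functional `Λ`,
  `Σ_(n,m) c_(n.1) Λ(σ_n)Λ(σ_m)·W_nW_mψ̂ ≤ (8 + 12(b²+1)/b)|β'| · Σ_n c_(n.1) Λ(σ_n)²`   (`ψ̂ = β'Σ_p Re tr U_p`).
Proof: weight exchange (`weight_smul_noiseField_bracket_eq_zero`) symmetrises the left side, polarisation writes it as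
`(β'/2)[H(A+B) − H(A) − H(B)]` with the venture's plaquette Hessian form `H = hessianForm` (`fderiv_frameDeriv_eq_mul_hessianForm`, g25)
and `A_e = √2Σ_ν Λ(σ_(e,ν))𝐩E_ν`, `B_e = c_e A_e`; per plaquette the polarised word is bounded by `abs_word2_wcross_le`; the edge
count `Σ_p Σ_(e∈p) = 4Σ_e` (`sum_plaquette_nsq`) and `‖A_e‖² ≤ 2Σ_ν Λ(σ_(e,ν))²` finish.  With `b = √a` the rate
`1 − K₀/2 = 1 − (4 + 6√a + 6/√a)|β'|` dominates Shen–Zhu–Zhu's `K̃_𝒮 = 1 − 8(1+√a)|β'|` (CMP 400 (2023) Lemma 5.1, (5.15), `N = 2`,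
`d = 3`, tree coupling `β' = 2β`) for every `a ≥ 1`.
THEOREMS ONLY, no definition, no sorry.  HONEST FRAMING: fixed-cut-off algebra; nothing K-uniform; no crux, rung or summit statement
is proved; the Yang–Mills mass gap is NOT proved.
-/

set_option autoImplicit false

noncomputable section

namespace Summit.QuantumFields.YangMills.Theorems.ColdStartUniversality

open MeasureTheory Matrix Complex Finset
open scoped ComplexConjugate BigOperators Matrix
open Literature.MathematicalPhysics.QuantumFieldTheory
open Literature.MathematicalPhysics.QuantumLattice (fundamentalRep fundamentalLatticeRep continuous_fundamentalRep fundamentalRep_apply)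
open Summit.Ventures.YMGap.HessianSharp (perturb wilsonRe plaqRe plaqHess hessianForm tangentNormSq frobSq word2 frobSq_neg sum_shift)

variable {L : ℕ} [NeZero L]

/-- **Edge count on the 3-torus**: every link of `(ℤ/L)³` lies on exactly four plaquettes —
`Σ_p Σ_(e ∈ p) g(e) = 4 Σ_e g(e)` for the four links `(x,i), (x+eᵢ,j), (x+eⱼ,i), (x,j)` of the plaquette `(x; i<j)`. [folklore] -/
theorem sum_plaquette_edges_three (g : Edge 3 L → ℝ) :
    ∑ p : Plaquette 3 L, (g (p.1, p.2.1.1) + g (p.1.shift p.2.1.1, p.2.1.2) + g (p.1.shift p.2.1.2, p.2.1.1) + g (p.1, p.2.1.2)) =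
      4 * ∑ e, g e := by
  classical
  have hG : ∀ μ ν : Fin 3, ∑ x : Site 3 L, g (x.shift μ, ν) = ∑ x : Site 3 L, g (x, ν) :=
    fun μ ν => sum_shift μ (fun x => g (x, ν))
  have hsub : ∀ F : Fin 3 × Fin 3 → ℝ, ∑ q : {q : Fin 3 × Fin 3 // q.1 < q.2}, F q.1 =
      ∑ q ∈ Finset.univ.filter (fun q : Fin 3 × Fin 3 => q.1 < q.2), F q := fun F =>
    (Finset.sum_subtype (Finset.univ.filter (fun q : Fin 3 × Fin 3 => q.1 < q.2)) (by simp) F).symm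
  have hE : ∑ e : Edge 3 L, g e = ∑ μ : Fin 3, ∑ x : Site 3 L, g (x, μ) := by
    rw [Fintype.sum_prod_type, Finset.sum_comm]
  rw [Fintype.sum_prod_type, Finset.sum_comm,
    hsub (fun q => ∑ x : Site 3 L, (g (x, q.1) + g (x.shift q.1, q.2) + g (x.shift q.2, q.1) + g (x, q.2))),
    Finset.sum_filter, Fintype.sum_prod_type, hE]
  simp only [Fin.sum_univ_three, Fin.isValue, Finset.sum_add_distrib, hG]
  norm_num [Fin.lt_def]
  ring

set_option maxHeartbeats 400000 in
/-- ★★ **Explicit weighted Hessian bound for the plaquette function along the noise frame.**  For `b ≥ 1` and a positive link weight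
`c` with `c_e ≤ b²·c_(e')` whenever `e, e'` lie on a common plaquette of `(ℤ/L)³`: for every configuration `V` and every functional `Λ`,
`Σ_(n,m) c_(n.1)·Λ(σ_n(y))Λ(σ_m(y))·D(z ↦ Dψ̂(z)[σ_m z])(y)[σ_n y] ≤ (8 + 12(b²+1)/b)·|β'|·Σ_n c_(n.1)Λ(σ_n(y))²`, `y = coords V`.
[cite: ShenZhuZhuCMP2023, Lemma 5.1 / (5.13)] -/
theorem wilson_whessBound (L : ℕ) [NeZero L] (β' b : ℝ) (hb : 1 ≤ b) (c : Edge 3 L → ℝ) (hc : ∀ e, 0 < c e)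
    (hcb : ∀ (p : Plaquette 3 L) (e e' : Edge 3 L), e ∈ ({(p.1, p.2.1.1), (p.1.shift p.2.1.1, p.2.1.2), (p.1.shift p.2.1.2, p.2.1.1), (p.1, p.2.1.2)} : Finset (Edge 3 L)) → e' ∈ ({(p.1, p.2.1.1), (p.1.shift p.2.1.1, p.2.1.2), (p.1.shift p.2.1.2, p.2.1.1), (p.1, p.2.1.2)} : Finset (Edge 3 L)) → c e ≤ b ^ 2 * c e') :
    ∀ (V : (GaugeConfig 3 L (Matrix.specialUnitaryGroup (Fin 2) ℂ))) (Λ : (Edge 3 L × Fin (fundamentalLatticeRep 2).N × Fin (fundamentalLatticeRep 2).N × Bool → ℝ) →L[ℝ] ℝ),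
      ∑ n : Edge 3 L × NoiseIdx (fundamentalLatticeRep 2).N, ∑ m : Edge 3 L × NoiseIdx (fundamentalLatticeRep 2).N,
        c n.1 * Λ ((fun q : Edge 3 L × Fin (fundamentalLatticeRep 2).N × Fin (fundamentalLatticeRep 2).N × Bool => if n.1 = q.1 then (fun z : ℂ => if q.2.2.2 then z.im else z.re) (((Real.sqrt 2 : ℂ) • ((fundamentalLatticeRep 2).lieProj (noiseDir n.2) * (fun (ee : Edge 3 L) => Matrix.of fun (i j : Fin (fundamentalLatticeRep 2).N) => (((fun (V : GaugeConfig 3 L (Matrix.specialUnitaryGroup (Fin 2) ℂ)) (q : Edge 3 L × Fin (fundamentalLatticeRep 2).N × Fin (fundamentalLatticeRep 2).N × Bool) => (fun z : ℂ => if q.2.2.2 then z.im else z.re) ((fundamentalRep (Fin 2) (V q.1) : Matrix (Fin 2) (Fin 2) ℂ) q.2.1 q.2.2.1)) V (ee, i, j, false) : ℝ) : ℂ) + (((fun (V : GaugeConfig 3 L (Matrix.specialUnitaryGroup (Fin 2) ℂ)) (q : Edge 3 L × Fin (fundamentalLatticeRep 2).N × Fin (fundamentalLatticeRep 2).N ×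 Bool) => (fun z : ℂ => if q.2.2.2 then z.im else z.re) ((fundamentalRep (Fin 2) (V q.1) : Matrix (Fin 2) (Fin 2) ℂ) q.2.1 q.2.2.1)) V (ee, i, j, true) : ℝ) : ℂ) * Complex.I) q.1)) q.2.1 q.2.2.1) else 0)) * Λ ((fun q : Edge 3 L × Fin (fundamentalLatticeRep 2).N × Fin (fundamentalLatticeRep 2).N × Bool => if m.1 = q.1 then (fun z : ℂ => if q.2.2.2 then z.im else z.re) (((Real.sqrt 2 : ℂ) • ((fundamentalLatticeRep 2).lieProj (noiseDir m.2) * (fun (ee : Edge 3 L) => Matrix.of fun (i j : Fin (fundamentalLatticeRep 2).N) => (((fun (V : GaugeConfig 3 L (Matrix.specialUnitaryGroup (Fin 2) ℂ)) (q : Edge 3 L × Fin (fundamentalLatticeRep 2).N × Fin (fundamentalLatticeRep 2).N × Bool) => (fun z : ℂ => if q.2.2.2 then z.im else z.re) ((fundamentalRep (Fin 2) (V q.1) : Matrix (Fin 2) (Fin 2) ℂ) q.2.1 q.2.2.1)) V (ee, i, j, false) : ℝ) : ℂ) + (((fun (V : GaugeConfig 3 L (Matrix.specialUnitaryGroup (Fin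 2) ℂ)) (q : Edge 3 L × Fin (fundamentalLatticeRep 2).N × Fin (fundamentalLatticeRep 2).N × Bool) => (fun z : ℂ => if q.2.2.2 then z.im else z.re) ((fundamentalRep (Fin 2) (V q.1) : Matrix (Fin 2) (Fin 2) ℂ) q.2.1 q.2.2.1)) V (ee, i, j, true) : ℝ) : ℂ) * Complex.I) q.1)) q.2.1 q.2.2.1) else 0)) *
          fderiv ℝ (fun z : (Edge 3 L × Fin (fundamentalLatticeRep 2).N × Fin (fundamentalLatticeRep 2).N × Bool → ℝ) => fderiv ℝ (fun y : (Edge 3 L × Fin (fundamentalLatticeRep 2).N × Fin (fundamentalLatticeRep 2).N × Bool → ℝ) => β' * ∑ p : Plaquette 3 L, (rootedLoop (fun (ee : Edge 3 L) (i j : Fin (fundamentalLatticeRep 2).N) => ((y (ee, i, j, false) : ℝ) : ℂ) + ((y (ee, i, j, true) : ℝ) : ℂ) * Complex.I) (p.1, p.2.1.1) p.2.1.2 false).trace.re) z (fun q : Edge 3 L × Fin (fundamentalLatticeRep 2).N × Fin (fundamentalLatticeRep 2).N × Bool => if m.1 = q.1 then (fun z : ℂ => if q.2.2.2 then z.im else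 z.re) (((Real.sqrt 2 : ℂ) • ((fundamentalLatticeRep 2).lieProj (noiseDir m.2) * (fun (ee : Edge 3 L) => Matrix.of fun (i j : Fin (fundamentalLatticeRep 2).N) => ((z (ee, i, j, false) : ℝ) : ℂ) + ((z (ee, i, j, true) : ℝ) : ℂ) * Complex.I) q.1)) q.2.1 q.2.2.1) else 0)) ((fun (V : GaugeConfig 3 L (Matrix.specialUnitaryGroup (Fin 2) ℂ)) (q : Edge 3 L × Fin (fundamentalLatticeRep 2).N × Fin (fundamentalLatticeRep 2).N × Bool) => (fun z : ℂ => if q.2.2.2 then z.im else z.re) ((fundamentalRep (Fin 2) (V q.1) : Matrix (Fin 2) (Fin 2) ℂ) q.2.1 q.2.2.1)) V) (fun q : Edge 3 L × Fin (fundamentalLatticeRep 2).N × Fin (fundamentalLatticeRep 2).N × Bool => if n.1 = q.1 then (fun z : ℂ => if q.2.2.2 then z.im else z.re) (((Real.sqrt 2 : ℂ) • ((fundamentalLatticeRep 2).lieProj (noiseDir n.2) * (fun (ee : Edge 3 L) => Matrix.of fun (i j : Fin (fundamentalLatticeRep 2).N) => (((fun (V : GaugeConfig 3 L (Matrix.specialUnitaryGroup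 (Fin 2) ℂ)) (q : Edge 3 L × Fin (fundamentalLatticeRep 2).N × Fin (fundamentalLatticeRep 2).N × Bool) => (fun z : ℂ => if q.2.2.2 then z.im else z.re) ((fundamentalRep (Fin 2) (V q.1) : Matrix (Fin 2) (Fin 2) ℂ) q.2.1 q.2.2.1)) V (ee, i, j, false) : ℝ) : ℂ) + (((fun (V : GaugeConfig 3 L (Matrix.specialUnitaryGroup (Fin 2) ℂ)) (q : Edge 3 L × Fin (fundamentalLatticeRep 2).N × Fin (fundamentalLatticeRep 2).N × Bool) => (fun z : ℂ => if q.2.2.2 then z.im else z.re) ((fundamentalRep (Fin 2) (V q.1) : Matrix (Fin 2) (Fin 2) ℂ) q.2.1 q.2.2.1)) V (ee, i, j, true) : ℝ) : ℂ) * Complex.I) q.1)) q.2.1 q.2.2.1) else 0)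
        ≤ (8 + 12 * ((b ^ 2 + 1) / b)) * |β'| * ∑ n : Edge 3 L × NoiseIdx (fundamentalLatticeRep 2).N, c n.1 * (Λ (fun q : Edge 3 L × Fin (fundamentalLatticeRep 2).N × Fin (fundamentalLatticeRep 2).N × Bool => if n.1 = q.1 then (fun z : ℂ => if q.2.2.2 then z.im else z.re) (((Real.sqrt 2 : ℂ) • ((fundamentalLatticeRep 2).lieProj (noiseDir n.2) * (fun (ee : Edge 3 L) => Matrix.of fun (i j : Fin (fundamentalLatticeRep 2).N) => (((fun (V : GaugeConfig 3 L (Matrix.specialUnitaryGroup (Fin 2) ℂ)) (q : Edge 3 L × Fin (fundamentalLatticeRep 2).N × Fin (fundamentalLatticeRep 2).N × Bool) => (fun z : ℂ => if q.2.2.2 then z.im else z.re) ((fundamentalRep (Fin 2) (V q.1) : Matrix (Fin 2) (Fin 2) ℂ) q.2.1 q.2.2.1)) V (ee, i, j, false) : ℝ) : ℂ) + (((fun (V : GaugeConfig 3 L (Matrix.specialUnitaryGroup (Fin 2) ℂ)) (q : Edge 3 L × Fin (fundamentalLatticeRep 2).N × Fin (fundamentalLatticeRep 2).N × Bool) =>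 (fun z : ℂ => if q.2.2.2 then z.im else z.re) ((fundamentalRep (Fin 2) (V q.1) : Matrix (Fin 2) (Fin 2) ℂ) q.2.1 q.2.2.1)) V (ee, i, j, true) : ℝ) : ℂ) * Complex.I) q.1)) q.2.1 q.2.2.1) else 0)) ^ 2 := by
  intro V Λ
  classical
  obtain ⟨s, cc, hs, -, -, -, -⟩ := exists_noiseFrame L
  -- abbreviations
  set P : NoiseIdx (fundamentalLatticeRep 2).N → Matrix (Fin (fundamentalLatticeRep 2).N) (Fin (fundamentalLatticeRep 2).N) ℂ := fun ν => (fundamentalLatticeRep 2).lieProj (noiseDir ν) with hP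
  set reb : (Edge 3 L × Fin (fundamentalLatticeRep 2).N × Fin (fundamentalLatticeRep 2).N × Bool → ℝ) → (Edge 3 L → Matrix (Fin (fundamentalLatticeRep 2).N) (Fin (fundamentalLatticeRep 2).N) ℂ) := fun z => (fun (ee : Edge 3 L) => Matrix.of fun (i j : Fin (fundamentalLatticeRep 2).N) => ((z (ee, i, j, false) : ℝ) : ℂ) + ((z (ee, i, j, true) : ℝ) : ℂ) * Complex.I) with hreb
  set flat : (Edge 3 L → Matrix (Fin (fundamentalLatticeRep 2).N) (Fin (fundamentalLatticeRep 2).N) ℂ) → (Edge 3 L × Fin (fundamentalLatticeRep 2).N × Fin (fundamentalLatticeRep 2).N × Bool → ℝ) := fun M => (fun q : Edge 3 L × Fin (fundamentalLatticeRep 2).N × Fin (fundamentalLatticeRep 2).N × Bool => (fun z : ℂ => if q.2.2.2 then z.im else z.re) (M q.1 q.2.1 q.2.2.1)) with hflat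
  set σ : (Edge 3 L × NoiseIdx (fundamentalLatticeRep 2).N) → (Edge 3 L × Fin (fundamentalLatticeRep 2).N × Fin (fundamentalLatticeRep 2).N × Bool → ℝ) → (Edge 3 L × Fin (fundamentalLatticeRep 2).N × Fin (fundamentalLatticeRep 2).N × Bool → ℝ) := fun n z => (fun q : Edge 3 L × Fin (fundamentalLatticeRep 2).N × Fin (fundamentalLatticeRep 2).N × Bool => if n.1 = q.1 then (fun z : ℂ => if q.2.2.2 then z.im else z.re) (((Real.sqrt 2 : ℂ) • ((fundamentalLatticeRep 2).lieProj (noiseDir n.2) * (fun (ee : Edge 3 L) => Matrix.of fun (i j : Fin (fundamentalLatticeRep 2).N) => ((z (ee, i, j, false) : ℝ) : ℂ) + ((z (ee, i, j, true) : ℝ) : ℂ) * Complex.I) q.1)) q.2.1 q.2.2.1) else 0) with hσ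
  set ψ : (Edge 3 L × Fin (fundamentalLatticeRep 2).N × Fin (fundamentalLatticeRep 2).N × Bool → ℝ) → ℝ := (fun y : (Edge 3 L × Fin (fundamentalLatticeRep 2).N × Fin (fundamentalLatticeRep 2).N × Bool → ℝ) => β' * ∑ p : Plaquette 3 L, (rootedLoop (fun (ee : Edge 3 L) (i j : Fin (fundamentalLatticeRep 2).N) => ((y (ee, i, j, false) : ℝ) : ℂ) + ((y (ee, i, j, true) : ℝ) : ℂ) * Complex.I) (p.1, p.2.1.1) p.2.1.2 false).trace.re) with hψ
  set y : (Edge 3 L × Fin (fundamentalLatticeRep 2).N × Fin (fundamentalLatticeRep 2).N × Bool → ℝ) := ((fun (V : GaugeConfig 3 L (Matrix.specialUnitaryGroup (Fin 2) ℂ)) (q : Edge 3 L × Fin (fundamentalLatticeRep 2).N × Fin (fundamentalLatticeRep 2).N × Bool) => (fun z : ℂ => if q.2.2.2 then z.im else z.re) ((fundamentalRep (Fin 2) (V q.1) : Matrix (Fin 2) (Fin 2) ℂ) q.2.1 q.2.2.1)) V) with hy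
  have hsσ : ∀ n z, s n z = σ n z := fun n z => hs n z
  have r_smul : ∀ (a : ℝ) (v : (Edge 3 L × Fin (fundamentalLatticeRep 2).N × Fin (fundamentalLatticeRep 2).N × Bool → ℝ)), reb (a • v) = (a : ℂ) • reb v := fun a v => rebuild_smul a v
  have r_sum : ∀ f : (Edge 3 L × NoiseIdx (fundamentalLatticeRep 2).N) → (Edge 3 L × Fin (fundamentalLatticeRep 2).N × Fin (fundamentalLatticeRep 2).N × Bool → ℝ), reb (∑ k, f k) = ∑ k, reb (f k) := fun f => rebuild_sum Finset.univ f
  have r_inj : ∀ v w : (Edge 3 L × Fin (fundamentalLatticeRep 2).N × Fin (fundamentalLatticeRep 2).N × Bool → ℝ), reb v = reb w → v = w := fun v w h => eq_of_rebuild_eq h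
  have r_flat : ∀ M : (Edge 3 L → Matrix (Fin (fundamentalLatticeRep 2).N) (Fin (fundamentalLatticeRep 2).N) ℂ), reb (flat M) = M := fun M => rebuild_flat_of M
  have r_σ : ∀ n z, reb (σ n z) = fun e => if n.1 = e then (Real.sqrt 2 : ℂ) • (P n.2 * reb z e) else 0 := fun n z => rebuild_noise n z
  have flat_reb : ∀ v : (Edge 3 L × Fin (fundamentalLatticeRep 2).N × Fin (fundamentalLatticeRep 2).N × Bool → ℝ), flat (reb v) = v := fun v => r_inj _ _ (r_flat _)
  have cx : ∀ (a : ℝ) (W : Matrix (Fin (fundamentalLatticeRep 2).N) (Fin (fundamentalLatticeRep 2).N) ℂ), a • W = (a : ℂ) • W := fun a W => by ext i j; simp only [Matrix.smul_apply, Complex.real_smul, smul_eq_mul]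
  -- configuration matrices and their unitarity
  set Q : Edge 3 L → Matrix (Fin (fundamentalLatticeRep 2).N) (Fin (fundamentalLatticeRep 2).N) ℂ := fun e => Matrix.of fun i j : Fin (fundamentalLatticeRep 2).N => (fundamentalRep (Fin 2) (V e) : Matrix (Fin 2) (Fin 2) ℂ) i j with hQ
  have hrebY : reb y = Q := rebuild_coords_of V
  have hyQ : flat Q = y := by rw [← hrebY, flat_reb]
  have hQU : ∀ e, Q e ∈ Matrix.unitaryGroup (Fin (fundamentalLatticeRep 2).N) ℂ := fun e => Matrix.specialUnitaryGroup_le_unitaryGroup (V e).2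
  have hψC : ContDiff ℝ 2 ψ := contDiff_psiHat (d := 3) (L := L) (N := (fundamentalLatticeRep 2).N) (n := 2) β'
  have hψW : ∀ M : (Edge 3 L → Matrix (Fin (fundamentalLatticeRep 2).N) (Fin (fundamentalLatticeRep 2).N) ℂ), ψ (flat M) = β' * wilsonRe M := by
    intro M
    have h1 : ψ (flat M) = β' * ∑ p : Plaquette 3 L, (rootedLoop (reb (flat M)) (p.1, p.2.1.1) p.2.1.2 false).trace.re := rfl
    rw [h1, r_flat]
    simp only [wilsonRe, plaqRe, rootedLoop]
  -- the coefficient vectors: `x` and the weighted `x'`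
  set x : Edge 3 L × NoiseIdx (fundamentalLatticeRep 2).N → ℝ := fun n => Λ (s n y) with hx
  -- for a coefficient vector `p`: the field `S_p = Σ p_n s_n`, the matrices `A_p`, `S_p z = flat(A_p · rebuild z)`, `H(p,p) = β' H_Q(A_p)`
  have hfield : ∀ p : Edge 3 L × NoiseIdx (fundamentalLatticeRep 2).N → ℝ, ∃ (S : (Edge 3 L × Fin (fundamentalLatticeRep 2).N × Fin (fundamentalLatticeRep 2).N × Bool → ℝ) →L[ℝ] (Edge 3 L × Fin (fundamentalLatticeRep 2).N × Fin (fundamentalLatticeRep 2).N × Bool → ℝ)) (A : Edge 3 L → Matrix (Fin (fundamentalLatticeRep 2).N) (Fin (fundamentalLatticeRep 2).N) ℂ),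
      (∀ z, S z = ∑ n, p n • s n z) ∧ (A = fun e => (Real.sqrt 2 : ℂ) • ∑ ν, p (e, ν) • P ν) ∧ (∀ e, (A e)ᴴ = -A e) ∧
      (∀ z, S z = flat (fun e => A e * reb z e)) ∧
      fderiv ℝ (fun z => fderiv ℝ ψ z (S z)) y (S y) = β' * hessianForm Q A := by
    intro p
    set S : (Edge 3 L × Fin (fundamentalLatticeRep 2).N × Fin (fundamentalLatticeRep 2).N × Bool → ℝ) →L[ℝ] (Edge 3 L × Fin (fundamentalLatticeRep 2).N × Fin (fundamentalLatticeRep 2).N × Bool → ℝ) := ∑ n, p n • s n with hSdef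
    have hS_apply : ∀ z, S z = ∑ n, p n • s n z := fun z => by
      rw [hSdef, _root_.sum_apply]; simp only [FunLike.coe_smul, Pi.smul_apply]
    set Z : Edge 3 L → Matrix (Fin (fundamentalLatticeRep 2).N) (Fin (fundamentalLatticeRep 2).N) ℂ := fun e => ∑ ν, p (e, ν) • P ν with hZ
    set A : Edge 3 L → Matrix (Fin (fundamentalLatticeRep 2).N) (Fin (fundamentalLatticeRep 2).N) ℂ := fun e => (Real.sqrt 2 : ℂ) • Z e with hA
    have hZmem : ∀ e, Z e ∈ (fundamentalLatticeRep 2).lieAlg := fun e =>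
      Submodule.sum_mem _ fun ν _ => Submodule.smul_mem _ _ ((fundamentalLatticeRep 2).lieProj_mem _)
    have hZskew : ∀ e, (Z e)ᴴ = -Z e := fun e => by
      rw [← Matrix.star_eq_conjTranspose]; exact (fundamentalLatticeRep 2).star_eq_neg_of_mem_lieAlg (hZmem e)
    have hAskew : ∀ e, (A e)ᴴ = -A e := fun e => by
      simp only [hA, Matrix.conjTranspose_smul, RCLike.star_def, Complex.conj_ofReal, hZskew, smul_neg]
    have hrebS : ∀ z, reb (S z) = fun e => A e * reb z e := by
      intro z
      rw [hS_apply, r_sum]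
      simp_rw [r_smul, hsσ, r_σ]
      funext e
      rw [Finset.sum_apply]
      have hsplit : ∑ n : Edge 3 L × NoiseIdx (fundamentalLatticeRep 2).N,
          ((p n : ℂ) • (fun e' : Edge 3 L => if n.1 = e' then (Real.sqrt 2 : ℂ) • (P n.2 * reb z e') else (0 : Matrix (Fin (fundamentalLatticeRep 2).N) (Fin (fundamentalLatticeRep 2).N) ℂ))) e
          = ∑ e' : Edge 3 L, ∑ ν : NoiseIdx (fundamentalLatticeRep 2).N,
            ((p (e', ν) : ℂ) • (fun e'' : Edge 3 L => if (e', ν).1 = e'' then (Real.sqrt 2 : ℂ) • (P (e', ν).2 * reb z e'') else (0 : Matrix (Fin (fundamentalLatticeRep 2).N) (Fin (fundamentalLatticeRep 2).N) ℂ))) e :=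
        Fintype.sum_prod_type _
      rw [hsplit, Finset.sum_eq_single e (fun e' _ hne => Finset.sum_eq_zero fun ν _ => by
        simp only [Pi.smul_apply, if_neg hne, smul_zero]) (fun h => absurd (Finset.mem_univ e) h)]
      simp only [Pi.smul_apply, if_true, hA, hZ, Finset.smul_sum, Finset.sum_mul, Matrix.smul_mul]
      refine Finset.sum_congr rfl fun ν _ => ?_
      rw [cx, smul_comm]
    have hSflat : ∀ z, S z = flat (fun e => A e * reb z e) := fun z => r_inj _ _ ((hrebS z).trans (r_flat _).symm)
    refine ⟨S, A, hS_apply, rfl, hAskew, hSflat, ?_⟩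
    have h : fderiv ℝ (fun z => fderiv ℝ ψ z (S z)) (flat Q) (S (flat Q)) = β' * hessianForm Q A :=
      fderiv_frameDeriv_eq_mul_hessianForm Q A hAskew β' ψ hψC hψW S hSflat
    rw [hyQ] at h
    exact h
  obtain ⟨Tm, hTm⟩ : ∃ Tm : Edge 3 L × NoiseIdx (fundamentalLatticeRep 2).N → Edge 3 L × NoiseIdx (fundamentalLatticeRep 2).N → ℝ, Tm = fun n m => fderiv ℝ (fun z => fderiv ℝ ψ z (s m z)) y (s n y) := ⟨_, rfl⟩
  have hTnm : ∀ n m, fderiv ℝ (fun z => fderiv ℝ ψ z (s m z)) y (s n y) = Tm n m := fun n m => by rw [hTm]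
  -- bilinear expansion of the second frame derivative along two combined fields
  have hexp : ∀ (p q : Edge 3 L × NoiseIdx (fundamentalLatticeRep 2).N → ℝ) (Sp Sq : (Edge 3 L × Fin (fundamentalLatticeRep 2).N × Fin (fundamentalLatticeRep 2).N × Bool → ℝ) →L[ℝ] (Edge 3 L × Fin (fundamentalLatticeRep 2).N × Fin (fundamentalLatticeRep 2).N × Bool → ℝ)), (∀ z, Sp z = ∑ n, p n • s n z) → (∀ z, Sq z = ∑ n, q n • s n z) →
      fderiv ℝ (fun z => fderiv ℝ ψ z (Sq z)) y (Sp y) = ∑ n, ∑ m, p n * q m * Tm n m := by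
    intro p q Sp Sq hSp hSq
    have hGsum : (fun z => fderiv ℝ ψ z (Sq z)) = fun z => ∑ m, q m * fderiv ℝ ψ z (s m z) := by
      funext z; rw [hSq, map_sum]; exact Finset.sum_congr rfl fun m _ => by rw [map_smul, smul_eq_mul]
    rw [hGsum, fderiv_sum_mul_apply Finset.univ q (fun m _ => differentiableAt_frameDeriv hψC (s m) y) (Sp y)]
    simp_rw [hSp, map_sum, map_smul, smul_eq_mul, Finset.mul_sum]
    rw [Finset.sum_comm]
    exact Finset.sum_congr rfl fun n _ => Finset.sum_congr rfl fun m _ => by rw [← hTnm]; ring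
  -- the three coefficient vectors
  obtain ⟨S₁, A₁, hS₁, hA₁, -, -, hH₁⟩ := hfield x
  obtain ⟨S₂, A₂, hS₂, hA₂, -, -, hH₂⟩ := hfield (fun n => c n.1 * x n)
  obtain ⟨S₃, A₃, hS₃, hA₃, -, -, hH₃⟩ := hfield (fun n => x n + c n.1 * x n)
  have hA₂e : ∀ e, A₂ e = (c e : ℂ) • A₁ e := by
    intro e; rw [hA₂, hA₁]; dsimp only
    simp only [cx, Complex.ofReal_mul, Finset.smul_sum, smul_smul]
    exact Finset.sum_congr rfl fun ν _ => by congr 1; ring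
  have hA₃e : ∀ e, A₃ e = A₁ e + A₂ e := by
    intro e; rw [hA₃, hA₁, hA₂]; dsimp only
    rw [← smul_add, ← Finset.sum_add_distrib]
    congr 1; exact Finset.sum_congr rfl fun ν _ => by rw [add_smul]
  -- `T := Σ c_n x_n x_m T_nm`; symmetry by weight exchange, then polarisation
  have hX : ∀ n m, (c n.1 - c m.1) * (Tm m n - Tm n m) = 0 := by
    intro n m
    have hw := weight_smul_noiseField_bracket_eq_zero (L := L) s hs c
    have h := weight_sub_mul_comm_eq_zero hψC s (fun n => c n.1) hw n m y
    rw [hTnm, hTnm] at h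
    exact h
  have hanti : ∑ n, ∑ m, (c n.1 - c m.1) * (x n * x m) * Tm n m = 0 := by
    have hD : ∑ n, ∑ m, (c n.1 - c m.1) * (x n * x m) * Tm n m = ∑ n, ∑ m, (c n.1 - c m.1) * (x n * x m) * Tm m n :=
      Finset.sum_congr rfl fun n _ => Finset.sum_congr rfl fun m _ => by
        have h := hX n m
        have e : (c n.1 - c m.1) * (x n * x m) * Tm n m - (c n.1 - c m.1) * (x n * x m) * Tm m n =
            -(x n * x m) * ((c n.1 - c m.1) * (Tm m n - Tm n m)) := by ring
        rw [h, mul_zero, sub_eq_zero] at e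
        exact e
    have hD' : ∑ n, ∑ m, (c n.1 - c m.1) * (x n * x m) * Tm m n = -∑ n, ∑ m, (c n.1 - c m.1) * (x n * x m) * Tm n m := by
      rw [Finset.sum_comm, ← Finset.sum_neg_distrib]
      refine Finset.sum_congr rfl fun n _ => ?_
      rw [← Finset.sum_neg_distrib]
      exact Finset.sum_congr rfl fun m _ => by ring
    linarith
  have h21 : fderiv ℝ (fun z => fderiv ℝ ψ z (S₁ z)) y (S₂ y) = fderiv ℝ (fun z => fderiv ℝ ψ z (S₂ z)) y (S₁ y) := by
    rw [hexp _ _ S₂ S₁ hS₂ hS₁, hexp _ _ S₁ S₂ hS₁ hS₂, ← sub_eq_zero, ← Finset.sum_sub_distrib]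
    rw [← hanti]
    refine Finset.sum_congr rfl fun n _ => ?_
    rw [← Finset.sum_sub_distrib]
    exact Finset.sum_congr rfl fun m _ => by ring
  have hpol : 2 * ∑ n, ∑ m, c n.1 * x n * x m * Tm n m = β' * (hessianForm Q A₃ - hessianForm Q A₁ - hessianForm Q A₂) := by
    have e3 := hexp _ _ S₃ S₃ hS₃ hS₃
    have e1 := hexp _ _ S₁ S₁ hS₁ hS₁
    have e2 := hexp _ _ S₂ S₂ hS₂ hS₂
    have e21 := hexp _ _ S₂ S₁ hS₂ hS₁
    have e12 := hexp _ _ S₁ S₂ hS₁ hS₂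
    rw [mul_sub, mul_sub, ← hH₃, ← hH₁, ← hH₂, e3, e1, e2]
    have hT : ∑ n, ∑ m, c n.1 * x n * x m * Tm n m = fderiv ℝ (fun z => fderiv ℝ ψ z (S₁ z)) y (S₂ y) := by
      rw [e21]
    have hsum : ∑ n, ∑ m, (x n + c n.1 * x n) * (x m + c m.1 * x m) * Tm n m =
        ∑ n, ∑ m, x n * x m * Tm n m + ∑ n, ∑ m, c n.1 * x n * x m * Tm n m + ∑ n, ∑ m, x n * (c m.1 * x m) * Tm n m +
          ∑ n, ∑ m, c n.1 * x n * (c m.1 * x m) * Tm n m := by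
      rw [← Finset.sum_add_distrib, ← Finset.sum_add_distrib, ← Finset.sum_add_distrib]
      refine Finset.sum_congr rfl fun n _ => ?_
      rw [← Finset.sum_add_distrib, ← Finset.sum_add_distrib, ← Finset.sum_add_distrib]
      exact Finset.sum_congr rfl fun m _ => by ring
    have h12' : ∑ n, ∑ m, x n * (c m.1 * x m) * Tm n m = ∑ n, ∑ m, c n.1 * x n * x m * Tm n m := by
      rw [hT, h21, e12]
    rw [hsum, h12']
    ring
  -- per plaquette: the polarised word and its weighted bound
  have hθpos : 0 < b := lt_of_lt_of_le one_pos hb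
  have hplaq : ∀ p : Plaquette 3 L, |plaqHess Q A₃ p.1 p.2.1.1 p.2.1.2 - plaqHess Q A₁ p.1 p.2.1.1 p.2.1.2 - plaqHess Q A₂ p.1 p.2.1.1 p.2.1.2| ≤
      2 * (1 + 3 * ((b ^ 2 + 1) / (2 * b))) * (c (p.1, p.2.1.1) * frobSq (A₁ (p.1, p.2.1.1)) + c (p.1.shift p.2.1.1, p.2.1.2) * frobSq (A₁ (p.1.shift p.2.1.1, p.2.1.2)) +
        c (p.1.shift p.2.1.2, p.2.1.1) * frobSq (A₁ (p.1.shift p.2.1.2, p.2.1.1)) + c (p.1, p.2.1.2) * frobSq (A₁ (p.1, p.2.1.2))) := by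
    intro p
    have m₁ : (p.1, p.2.1.1) ∈ ({(p.1, p.2.1.1), (p.1.shift p.2.1.1, p.2.1.2), (p.1.shift p.2.1.2, p.2.1.1), (p.1, p.2.1.2)} : Finset (Edge 3 L)) := by simp
    have m₂ : (p.1.shift p.2.1.1, p.2.1.2) ∈ ({(p.1, p.2.1.1), (p.1.shift p.2.1.1, p.2.1.2), (p.1.shift p.2.1.2, p.2.1.1), (p.1, p.2.1.2)} : Finset (Edge 3 L)) := by simp
    have m₃ : (p.1.shift p.2.1.2, p.2.1.1) ∈ ({(p.1, p.2.1.1), (p.1.shift p.2.1.1, p.2.1.2), (p.1.shift p.2.1.2, p.2.1.1), (p.1, p.2.1.2)} : Finset (Edge 3 L)) := by simp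
    have m₄ : (p.1, p.2.1.2) ∈ ({(p.1, p.2.1.1), (p.1.shift p.2.1.1, p.2.1.2), (p.1.shift p.2.1.2, p.2.1.1), (p.1, p.2.1.2)} : Finset (Edge 3 L)) := by simp
    have hsc : ∀ e, ((1 + c e : ℝ) : ℂ) • A₁ e = A₁ e + A₂ e := fun e => by
      rw [hA₂e e]; push_cast; rw [add_smul, one_smul]
    have hsc' : ∀ e, ((1 + c e : ℝ) : ℂ) • (-A₁ e) = -(A₁ e + A₂ e) := fun e => by rw [smul_neg, hsc e]
    have hB2 : Q (p.1.shift p.2.1.1, p.2.1.2) * (Q (p.1.shift p.2.1.2, p.2.1.1))ᴴ ∈ Matrix.unitaryGroup (Fin (fundamentalLatticeRep 2).N) ℂ :=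
      mul_mem (hQU _) (Unitary.star_mem (hQU _))
    have hB3 : (Q (p.1, p.2.1.2))ᴴ ∈ Matrix.unitaryGroup (Fin (fundamentalLatticeRep 2).N) ℂ := Unitary.star_mem (hQU _)
    have hB4 : (1 : Matrix (Fin (fundamentalLatticeRep 2).N) (Fin (fundamentalLatticeRep 2).N) ℂ) ∈ Matrix.unitaryGroup (Fin (fundamentalLatticeRep 2).N) ℂ := one_mem _
    have h := abs_word2_wcross_le (A₁ (p.1, p.2.1.1)) (Q (p.1, p.2.1.1)) (A₁ (p.1.shift p.2.1.1, p.2.1.2)) (Q (p.1.shift p.2.1.1, p.2.1.2) * (Q (p.1.shift p.2.1.2, p.2.1.1))ᴴ) (-A₁ (p.1.shift p.2.1.2, p.2.1.1)) (Q (p.1, p.2.1.2))ᴴ (-A₁ (p.1, p.2.1.2)) 1 (hQU _) hB2 hB3 hB4 hb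
      (hc _) (hc _) (hc _) (hc _) (hcb p _ _ m₁ m₂) (hcb p _ _ m₂ m₁) (hcb p _ _ m₁ m₃) (hcb p _ _ m₃ m₁) (hcb p _ _ m₁ m₄) (hcb p _ _ m₄ m₁)
      (hcb p _ _ m₂ m₃) (hcb p _ _ m₃ m₂) (hcb p _ _ m₂ m₄) (hcb p _ _ m₄ m₂) (hcb p _ _ m₃ m₄) (hcb p _ _ m₄ m₃)
    rw [hsc, hsc, hsc', hsc', frobSq_neg, frobSq_neg] at h
    have e3 : plaqHess Q A₃ p.1 p.2.1.1 p.2.1.2 = word2 (A₁ (p.1, p.2.1.1) + A₂ (p.1, p.2.1.1)) (Q (p.1, p.2.1.1)) (A₁ (p.1.shift p.2.1.1, p.2.1.2) + A₂ (p.1.shift p.2.1.1, p.2.1.2)) (Q (p.1.shift p.2.1.1, p.2.1.2) * (Q (p.1.shift p.2.1.2, p.2.1.1))ᴴ) (-(A₁ (p.1.shift p.2.1.2, p.2.1.1) + A₂ (p.1.shift p.2.1.2, p.2.1.1))) (Q (p.1, p.2.1.2))ᴴ (-(A₁ (p.1, p.2.1.2) + A₂ (p.1, p.2.1.2))) 1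 := by
      simp only [plaqHess, hA₃e]
    have e1 : plaqHess Q A₁ p.1 p.2.1.1 p.2.1.2 = word2 (A₁ (p.1, p.2.1.1)) (Q (p.1, p.2.1.1)) (A₁ (p.1.shift p.2.1.1, p.2.1.2)) (Q (p.1.shift p.2.1.1, p.2.1.2) * (Q (p.1.shift p.2.1.2, p.2.1.1))ᴴ) (-A₁ (p.1.shift p.2.1.2, p.2.1.1)) (Q (p.1, p.2.1.2))ᴴ (-A₁ (p.1, p.2.1.2)) 1 := rfl
    have e2 : plaqHess Q A₂ p.1 p.2.1.1 p.2.1.2 = word2 ((c (p.1, p.2.1.1) : ℂ) • A₁ (p.1, p.2.1.1)) (Q (p.1, p.2.1.1)) ((c (p.1.shift p.2.1.1, p.2.1.2) : ℂ) • A₁ (p.1.shift p.2.1.1, p.2.1.2)) (Q (p.1.shift p.2.1.1, p.2.1.2) * (Q (p.1.shift p.2.1.2, p.2.1.1))ᴴ) ((c (p.1.shift p.2.1.2, p.2.1.1) : ℂ) • (-A₁ (p.1.shift p.2.1.2, p.2.1.1))) (Q (p.1, p.2.1.2))ᴴ ((c (p.1, p.2.1.2) : ℂ) • (-A₁ (p.1,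 p.2.1.2))) 1 := by
      simp only [plaqHess, hA₂e, smul_neg]
    rw [e3, e1, e2]
    exact h
  -- the edge count `Σ_p Σ_(e∈p) c_e ‖A_e‖² = 4 Σ_e c_e ‖A_e‖²`
  have hcount : ∑ p : Plaquette 3 L, (c (p.1, p.2.1.1) * frobSq (A₁ (p.1, p.2.1.1)) + c (p.1.shift p.2.1.1, p.2.1.2) * frobSq (A₁ (p.1.shift p.2.1.1, p.2.1.2)) +
        c (p.1.shift p.2.1.2, p.2.1.1) * frobSq (A₁ (p.1.shift p.2.1.2, p.2.1.1)) + c (p.1, p.2.1.2) * frobSq (A₁ (p.1, p.2.1.2))) =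
      4 * ∑ e, c e * frobSq (A₁ e) := by
    exact sum_plaquette_edges_three (L := L) (fun e => c e * frobSq (A₁ e))
  -- `‖A_e‖² ≤ 2 Σ_ν x_(e,ν)²`
  have hAe : ∀ e, frobSq (A₁ e) ≤ 2 * ∑ ν, x (e, ν) ^ 2 := by
    intro e
    have h1 : frobSq (A₁ e) = 2 * hsForm (fundamentalLatticeRep 2).N (∑ ν, x (e, ν) • P ν) (∑ ν, x (e, ν) • P ν) := by
      rw [hA₁]
      show hsForm (fundamentalLatticeRep 2).N ((Real.sqrt 2 : ℂ) • ∑ ν, x (e, ν) • P ν) ((Real.sqrt 2 : ℂ) • ∑ ν, x (e, ν) • P ν) = _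
      rw [hsForm_coe_smul_left, hsForm_coe_smul_right, ← mul_assoc, Real.mul_self_sqrt zero_le_two]
    have h2 : hsForm (fundamentalLatticeRep 2).N (∑ ν, x (e, ν) • P ν) (∑ ν, x (e, ν) • P ν) ≤ ∑ ν, x (e, ν) ^ 2 := by
      have hZp : ∑ ν, x (e, ν) • P ν = (fundamentalLatticeRep 2).lieProj (∑ ν, x (e, ν) • noiseDir ν) := by
        rw [map_sum]; simp only [map_smul, hP]
      rw [hZp, ← hsForm_sum_smul_noiseDir_self]
      exact hsForm_lieProj_self_le (fundamentalLatticeRep 2) _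
    rw [h1]; linarith
  -- assembly
  have main : ∑ n, ∑ m, c n.1 * x n * x m * Tm n m ≤ (8 + 12 * ((b ^ 2 + 1) / b)) * |β'| * ∑ n, c n.1 * x n ^ 2 := by
    have hsumd : hessianForm Q A₃ - hessianForm Q A₁ - hessianForm Q A₂ =
        ∑ p : Plaquette 3 L, (plaqHess Q A₃ p.1 p.2.1.1 p.2.1.2 - plaqHess Q A₁ p.1 p.2.1.1 p.2.1.2 - plaqHess Q A₂ p.1 p.2.1.1 p.2.1.2) := by
      simp only [hessianForm, Finset.sum_sub_distrib]
    have habs : |hessianForm Q A₃ - hessianForm Q A₁ - hessianForm Q A₂| ≤ 2 * (1 + 3 * ((b ^ 2 + 1) / (2 * b))) * (4 * ∑ e, c e * frobSq (A₁ e)) := by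
      rw [hsumd, ← hcount, Finset.mul_sum]
      exact (Finset.abs_sum_le_sum_abs _ _).trans (Finset.sum_le_sum fun p _ => hplaq p)
    have hedge : ∑ e, c e * frobSq (A₁ e) ≤ 2 * ∑ n, c n.1 * x n ^ 2 := by
      rw [Fintype.sum_prod_type (fun n : Edge 3 L × NoiseIdx (fundamentalLatticeRep 2).N => c n.1 * x n ^ 2), Finset.mul_sum]
      refine Finset.sum_le_sum fun e _ => ?_
      show c e * frobSq (A₁ e) ≤ 2 * ∑ ν, c e * x (e, ν) ^ 2
      rw [← Finset.mul_sum]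
      calc c e * frobSq (A₁ e) ≤ c e * (2 * ∑ ν, x (e, ν) ^ 2) := mul_le_mul_of_nonneg_left (hAe e) (hc e).le
        _ = 2 * (c e * ∑ ν, x (e, ν) ^ 2) := by ring
    have hθ0 : 0 ≤ 2 * (1 + 3 * ((b ^ 2 + 1) / (2 * b))) := by positivity
    have hxn : 0 ≤ ∑ n, c n.1 * x n ^ 2 := Finset.sum_nonneg fun n _ => mul_nonneg (hc n.1).le (sq_nonneg _)
    have h2T : 2 * ∑ n, ∑ m, c n.1 * x n * x m * Tm n m ≤ |β'| * (2 * (1 + 3 * ((b ^ 2 + 1) / (2 * b))) * (4 * (2 * ∑ n, c n.1 * x n ^ 2))) := by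
      rw [hpol]
      calc β' * (hessianForm Q A₃ - hessianForm Q A₁ - hessianForm Q A₂) ≤ |β' * (hessianForm Q A₃ - hessianForm Q A₁ - hessianForm Q A₂)| := le_abs_self _
        _ = |β'| * |hessianForm Q A₃ - hessianForm Q A₁ - hessianForm Q A₂| := abs_mul _ _
        _ ≤ |β'| * (2 * (1 + 3 * ((b ^ 2 + 1) / (2 * b))) * (4 * ∑ e, c e * frobSq (A₁ e))) := mul_le_mul_of_nonneg_left habs (abs_nonneg _)
        _ ≤ |β'| * (2 * (1 + 3 * ((b ^ 2 + 1) / (2 * b))) * (4 * (2 * ∑ n, c n.1 * x n ^ 2))) := by gcongr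
    have e : |β'| * (2 * (1 + 3 * ((b ^ 2 + 1) / (2 * b))) * (4 * (2 * ∑ n, c n.1 * x n ^ 2))) = 2 * ((8 + 12 * ((b ^ 2 + 1) / b)) * |β'| * ∑ n, c n.1 * x n ^ 2) := by
      field_simp
      ring
    rw [e] at h2T
    linarith
  -- back to the statement's vocabulary
  have hsz : ∀ k : Edge 3 L × NoiseIdx (fundamentalLatticeRep 2).N, (fun z : (Edge 3 L × Fin (fundamentalLatticeRep 2).N × Fin (fundamentalLatticeRep 2).N × Bool → ℝ) => fderiv ℝ ψ z (s k z)) = fun z => fderiv ℝ ψ z (σ k z) :=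
    fun k => funext fun z => congrArg (fderiv ℝ ψ z) (hs k z)
  have hsV : ∀ k : Edge 3 L × NoiseIdx (fundamentalLatticeRep 2).N, s k y = σ k y := fun k => hs k y
  simp only [hx, hTm, hsz, hsV] at main
  exact main

end Summit.QuantumFields.YangMills.Theorems.ColdStartUniversality
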